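import Summits.BirchSwinnertonDyer.Rank1Residual.X4.KuriharaLevelLoweringTwistMinus
import Summits.BirchSwinnertonDyer.Rank1Residual.Additive.SemistableTwistAnalyticOdd
import Summits.BirchSwinnertonDyer.Rank1Residual.Additive.RamifiedTwistMinimality
import Literature.NumberTheory.EllipticCurves.CuspFormTwistRatPlusSymbolOdd
import Literature.NumberTheory.EllipticCurves.ComplexMultiplicationBurungaleFlachProofs
import HarnessLib

/-!
# The level-lowering certificate of an additive curve `W = V ⊗ χ_{−p}` (`p ≡ 3 mod 4`, in particular `p = 3`) from the MINUS-symbol certificate of its semistable twist `V`, the period bookkeeping DISCHARGED with NO named period fact (cell `b2b-bsdres`, seat additive-p4, line V40; odd twin of `X4TwistLevelLoweringCertificate`)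

HONEST FRAMING (verbatim, cell `b2b-bsdres`): the goal of the cell is to DELETE the COMBINATION-SHAPED
residual classes for ALL analytic-rank `≤ 1` curves over `ℚ` — "full BSD formula for every rank `≤ 1`
curve in class `C`" assembled STRICTLY from published theorems — so that the rank-`≤ 1` remainder
becomes exactly the CONSTRUCTION-SHAPED classes, which are TYPED (missing-input Props), NOT attempted;
this is not "finishing BSD". This file: research-route KERNEL THEOREMS; NO named fact (Pal 2012 Thm. 3.2
for `d = −p < 0` is PROVED in the tree, `realPeriodRat_mul_sqrt_of_twist_of_neg`; the unit `u(C)` is a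
`p`-adic unit by `padicValRat_u_eq_zero_of_twist_pm_p`); no definition, nothing booked; class X4 stays
CONSTRUCTION-SHAPED; the `V`-side certificate is a per-pair instrument output (EVIDENCE), never a fact.

## What is proved

At `p ≡ 3 (mod 4)` the character `χ_{p*} = χ_{−p}` is ODD, and the plus symbol of `f_W` is a twisted sum
of MINUS symbols of `f_V` (tree `ModularForms.exists_rat_forall_ratPlusSymbol_charTwist_eq_of_odd`).
* §1 `charTwist_eq_of_isNewformOf_neg`: `f_W = (f_V)_{χ_p}` by `q`-expansions (gen-2
  `intCast_LFunction_eq_jacobiChar_mul_cuspCoeff_of_neg`).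
* §2 `exists_rat_ratPlusSymbol_eq_legendreTwistMinusSum`: `[r]⁺_{f_W} = c₀·∑_u (u/p)[r + u/p]⁻_{f_V}`
  with ONE `c₀ ∈ ℚ`, and `c₀ · Ω⁺_{f_W} · τ(χ_p) = i Ω⁻_{f_V}` in the non-degenerate case.
* §3 `norm_ratCast_eq_one_of_period_relation_odd`: `|c₀|_p = 1` from that relation, `τ² = −p`, the PROVED
  Pal identity `Ω_W √p = |u(C)| · c_∞(W) · |Ω⁻(V)|`, `|u(C)|_p = 1`, `c_∞ ∈ {1,2}` (`p` odd), and the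
  transfers `Ω_W = u_W Ω⁺_{f_W}`, `|Ω⁻(V)| = u_V⁻ Ω⁻_{f_V}` with `p`-adic units: `c₀ = ± u_W/(u_V⁻ |u(C)| c_∞)`.
* §4 `plusSymbolLevelLowersAt_of_twist_certificate_minus`: `PlusSymbolLevelLowersAt W p f_W ℓ` from the
  `V`-side MINUS-symbol certificate data (`μ` periodic, Hecke with `a_q(V)` at the Kolyvagin primes of
  `(W,p)`, `[r]⁻_{f_V} ≡ μ(r) − wμ(ℓr)`, `w·(ℓ/p) = 1`, `p ∤ ℓ`), `p`-integral minus symbols of `f_V`, the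
  twist relation `a_q(W) ≡ (q/p)a_q(V)` and the two period transfers — the `p = 3` block of the cell.

## References

* V. Pal, Canad. Math. Bull. 55 (2012), Thm. 3.2, Prop. 2.5 (proved in the tree for `d < 0`). [cite: Pal2012, Thm. 3.2 and Prop. 2.5]
* G. Shimura (1971), Prop. 3.64; B. Mazur, J. Tate, J. Teitelbaum (1986), §I.8. [cite: MazurTateTeitelbaum1986Invent, §I.8]
* C.-H. Kim, Amer. J. Math. 148 (2026), §1.2.2, §1.4.3. [cite: Kim2022StructureSelmer, §1.2.2 and §1.4.3]
-/

noncomputable section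

open scoped Classical MatrixGroups ModularForm

open CongruenceSubgroup WeierstrassCurve Literature.NumberTheory.EllipticCurves
  Literature.NumberTheory.EllipticCurves.ModularForms
  Literature.NumberTheory.EllipticCurves.Rank1Residual
  Literature.NumberTheory.QuadraticFields
  Summit.BirchSwinnertonDyer.Rank1Residual.LevelLowering

namespace Summit.BirchSwinnertonDyer.Rank1Residual.Additive

variable (p : ℕ) [hp : Fact p.Prime]

/-! ### §1 The newform of `W` is the twist of the newform of `V` (`p* = −p`) -/

/-- **`f_W = (f_V)_{χ_p}`** at `p ≡ 3 (mod 4)` (`W ≅ V ⊗ χ_{−p}`), as cusp forms of level `N_W`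
(`N_V ∣ N_W`, `p² ∣ N_W`), by `q`-expansions. [cite: Shimura1971, Prop. 3.64] -/
theorem charTwist_eq_of_isNewformOf_neg (hp4 : p % 4 = 3) (V W : WeierstrassCurve ℚ) [V.IsElliptic]
    [W.IsElliptic] (hVW : ∃ C : VariableChange ℚ, C • V.quadraticTwist (-(p : ℚ)) = W) (hadd : Addv W p)
    {NV NW : ℕ} [NeZero NV] [NeZero NW] {fV : CuspForm (Gamma0 NV) 2} {fW : CuspForm (Gamma0 NW) 2}
    (hfV : IsNewformOf V fV) (hfW : IsNewformOf W fW) (hN : NV ∣ NW) (hm : p ^ 2 ∣ NW) :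
    haveI : NeZero p := ⟨hp.out.ne_zero⟩
    charTwist NW hN hm (jacobiChar_prime_ne_one_isQuadratic_isPrimitive p (by omega)).2.1 fV = fW := by
  haveI : NeZero p := ⟨hp.out.ne_zero⟩
  have hprim := (jacobiChar_prime_ne_one_isQuadratic_isPrimitive p (by omega)).2.2
  refine eq_of_forall_cuspCoeff_eq_gamma0 fun n ↦ ?_
  rw [cuspCoeff_charTwist NW hN hm _ hprim fV n, hfW.2 n,
    intCast_LFunction_eq_jacobiChar_mul_cuspCoeff_of_neg p hp4 V W hVW hadd hfV n]

/-! ### §2 The ℚ-level twist identity: plus symbols of `f_W` from MINUS symbols of `f_V` -/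

/-- **`[r]⁺_{f_W} = c₀ · ∑_{u mod p} (u/p) [r + u/p]⁻_{f_V}` with ONE `c₀ ∈ ℚ`** (`p ≡ 3 mod 4`), and
`c₀ · Ω⁺_{f_W} · τ(χ_p) = i Ω⁻_{f_V}` when some twisted sum is non-zero (tree
`exists_rat_forall_ratPlusSymbol_charTwist_eq_of_odd` and §1). [cite: MazurTateTeitelbaum1986Invent, §I.8] -/
theorem exists_rat_ratPlusSymbol_eq_legendreTwistMinusSum (hp4 : p % 4 = 3) (V W : WeierstrassCurve ℚ)
    [V.IsElliptic] [W.IsElliptic] (hVW : ∃ C : VariableChange ℚ, C • V.quadraticTwist (-(p : ℚ)) = W)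
    (hadd : Addv W p) {NV NW : ℕ} [NeZero NV] [NeZero NW] {fV : CuspForm (Gamma0 NV) 2}
    {fW : CuspForm (Gamma0 NW) 2} (hfV : IsNewformOf V fV) (hfW : IsNewformOf W fW) (hN : NV ∣ NW)
    (hm : p ^ 2 ∣ NW) :
    haveI : NeZero p := ⟨hp.out.ne_zero⟩
    ∃ c₀ : ℚ, (∀ r : ℚ, ratPlusSymbol fW r =
        c₀ * ∑ u : ZMod p, (legendreSym p (u.val : ℤ) : ℚ) * ratMinusSymbol fV (r + (u.val : ℚ) / p)) ∧
      ((∃ r : ℚ, ∑ u : ZMod p, (legendreSym p (u.val : ℤ) : ℚ) * ratMinusSymbol fV (r + (u.val : ℚ) / p) ≠ 0) →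
        (c₀ : ℂ) * (plusPeriod fW : ℂ) * gaussSum (jacobiChar p) (ZMod.stdAddChar (N := p)) =
          (minusPeriod fV : ℂ) * Complex.I) := by
  haveI : NeZero p := ⟨hp.out.ne_zero⟩
  obtain ⟨_, hχq, hχp⟩ := jacobiChar_prime_ne_one_isQuadratic_isPrimitive p (show p ≠ 2 by omega)
  have hχo := jacobiChar_odd_of_mod_four_eq_three p hp4
  have hFW := charTwist_eq_of_isNewformOf_neg p hp4 V W hVW hadd hfV hfW hN hm
  have hε : ∀ u : ZMod p, jacobiChar p u = (((fun u : ZMod p ↦ legendreSym p (u.val : ℤ)) u : ℤ) : ℂ) := by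
    intro u
    rw [jacobiChar_apply, ← jacobiSym.legendreSym.to_jacobiSym]
  have hF : IsNewform0 (charTwist NW hN hm hχq fV) := by rw [hFW]; exact hfW.1
  have hQF : coeffField (charTwist NW hN hm hχq fV) = ⊥ := by rw [hFW]; exact hfW.coeffField_eq_bot
  obtain ⟨c, hc, hrel⟩ := exists_rat_forall_ratPlusSymbol_charTwist_eq_of_odd NW hN hm hχq hχo hχp hfV.1
    hfV.coeffField_eq_bot hF hQF (fun u : ZMod p ↦ legendreSym p (u.val : ℤ)) hε
  rw [hFW] at hc hrel
  exact ⟨c, fun r ↦ by simpa only [twistShift] using hc r,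
    fun ⟨r, hr⟩ ↦ hrel ⟨r, by simpa only [twistShift] using hr⟩⟩

/-! ### §3 The constant is a `p`-adic unit (odd case) -/

/-- **`|c₀|_p = 1` from the odd period relation.** If `c₀ · Ω⁺_{f_W} · τ = Ω⁻_{f_V} · i` with
`τ² = −p`, `Ω_W · √p = a · c · |Ω⁻(V)|` (Pal for `d = −p`: `a = |u(C)|`, `c = c_∞(W)`),
`Ω_W = u_W Ω⁺_{f_W}`, `|Ω⁻(V)| = u_V Ω⁻_{f_V}`, with rationals `u_W, u_V, a, c` of `p`-adic norm `1` and
`Ω_W > 0`, then `c₀ = ± u_W/(u_V a c)` is a `p`-adic unit. [cite: Pal2012, Thm. 3.2 and Prop. 2.5] -/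
theorem norm_ratCast_eq_one_of_period_relation_odd {c₀ uW uV a c : ℚ} {ΩW ΩVm ΩfW ΩfVm : ℝ} {τ : ℂ}
    (hτ : τ ^ 2 = -(p : ℂ)) (hrel : (c₀ : ℂ) * (ΩfW : ℂ) * τ = (ΩfVm : ℂ) * Complex.I)
    (hPal : ΩW * Real.sqrt p = a * c * ΩVm) (hW : ΩW = uW * ΩfW) (hV : ΩVm = uV * ΩfVm)
    (huW : ‖(uW : ℚ_[p])‖ = 1) (huV : ‖(uV : ℚ_[p])‖ = 1) (ha : ‖(a : ℚ_[p])‖ = 1)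
    (hc : ‖(c : ℚ_[p])‖ = 1) (hΩW : 0 < ΩW) :
    ‖(c₀ : ℚ_[p])‖ = 1 := by
  have huW0 : uW ≠ 0 := by rintro rfl; simp at huW
  have huV0 : uV ≠ 0 := by rintro rfl; simp at huV
  have ha0 : a ≠ 0 := by rintro rfl; simp at ha
  have hc0 : c ≠ 0 := by rintro rfl; simp at hc
  set s : ℂ := ((Real.sqrt p : ℝ) : ℂ) with hs
  have hsqrt : s ^ 2 = (p : ℂ) := by
    rw [hs, ← Complex.ofReal_pow, Real.sq_sqrt (Nat.cast_nonneg p)]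
    push_cast
    rfl
  have hs0 : s ≠ 0 := by
    rw [hs, Complex.ofReal_ne_zero]
    exact Real.sqrt_ne_zero'.mpr (by exact_mod_cast hp.out.pos)
  -- `τ = ± i s`
  have hτpm : τ = Complex.I * s ∨ τ = -(Complex.I * s) := by
    have hI : (Complex.I * s) ^ 2 = -(p : ℂ) := by rw [mul_pow, Complex.I_sq, hsqrt]; ring
    have h0 : (τ + Complex.I * s) * (τ - Complex.I * s) = 0 := by
      rw [← sq_sub_sq, hτ, hI, sub_self]
    rcases mul_eq_zero.mp h0 with h | h
    · exact Or.inr (eq_neg_of_add_eq_zero_left h)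
    · exact Or.inl (sub_eq_zero.mp h)
  -- the period identities, in `ℂ`
  have e1 : (ΩW : ℂ) = ((uW : ℚ) : ℂ) * (ΩfW : ℂ) := by
    have := congrArg (fun x : ℝ ↦ (x : ℂ)) hW
    push_cast at this
    exact this
  have e2 : (ΩVm : ℂ) = ((uV : ℚ) : ℂ) * (ΩfVm : ℂ) := by
    have := congrArg (fun x : ℝ ↦ (x : ℂ)) hV
    push_cast at this
    exact this
  have e3 : (ΩW : ℂ) * s = ((a : ℚ) : ℂ) * ((c : ℚ) : ℂ) * (ΩVm : ℂ) := by
    have := congrArg (fun x : ℝ ↦ (x : ℂ)) hPal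
    push_cast at this
    rw [hs]
    exact this
  have hΩfW0 : (ΩfW : ℂ) ≠ 0 := by
    intro h
    rw [h, mul_zero] at e1
    exact (hΩW.ne') (by exact_mod_cast e1)
  have huV0' : ((uV : ℚ) : ℂ) ≠ 0 := by exact_mod_cast huV0
  have ha0' : ((a : ℚ) : ℂ) ≠ 0 := by exact_mod_cast ha0
  have hc0' : ((c : ℚ) : ℂ) ≠ 0 := by exact_mod_cast hc0
  -- `c₀ τ u_V a c Ω⁺_{f_W} = i s u_W Ω⁺_{f_W}`; cancel `Ω⁺_{f_W}`
  have key : ((c₀ : ℚ) : ℂ) * τ * ((uV : ℚ) : ℂ) * ((a : ℚ) : ℂ) * ((c : ℚ) : ℂ) * (ΩfW : ℂ) =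
      Complex.I * s * ((uW : ℚ) : ℂ) * (ΩfW : ℂ) := by
    linear_combination (((uV : ℚ) : ℂ) * ((a : ℚ) : ℂ) * ((c : ℚ) : ℂ)) * hrel
      - (Complex.I * ((a : ℚ) : ℂ) * ((c : ℚ) : ℂ)) * e2 - Complex.I * e3 + (Complex.I * s) * e1
  have key' : ((c₀ : ℚ) : ℂ) * τ * ((uV : ℚ) : ℂ) * ((a : ℚ) : ℂ) * ((c : ℚ) : ℂ) =
      Complex.I * s * ((uW : ℚ) : ℂ) := mul_right_cancel₀ hΩfW0 key
  have hIs0 : Complex.I * s ≠ 0 := mul_ne_zero Complex.I_ne_zero hs0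
  have hden : ((uV : ℚ) : ℂ) * ((a : ℚ) : ℂ) * ((c : ℚ) : ℂ) ≠ 0 :=
    mul_ne_zero (mul_ne_zero huV0' ha0') hc0'
  have hcval : c₀ = uW / (uV * a * c) ∨ c₀ = -(uW / (uV * a * c)) := by
    rcases hτpm with h | h
    · left
      rw [h] at key'
      have h2 : ((c₀ : ℚ) : ℂ) * (((uV : ℚ) : ℂ) * ((a : ℚ) : ℂ) * ((c : ℚ) : ℂ)) = ((uW : ℚ) : ℂ) := by
        apply mul_left_cancel₀ hIs0
        linear_combination key'
      have : ((c₀ : ℚ) : ℂ) = ((uW / (uV * a * c) : ℚ) : ℂ) := by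
        push_cast
        field_simp
        linear_combination h2
      exact_mod_cast this
    · right
      rw [h] at key'
      have h2 : ((c₀ : ℚ) : ℂ) * (((uV : ℚ) : ℂ) * ((a : ℚ) : ℂ) * ((c : ℚ) : ℂ)) = -((uW : ℚ) : ℂ) := by
        apply mul_left_cancel₀ hIs0
        linear_combination -key'
      have : ((c₀ : ℚ) : ℂ) = ((-(uW / (uV * a * c)) : ℚ) : ℂ) := by
        push_cast
        field_simp
        linear_combination h2
      exact_mod_cast this
  rcases hcval with h | h
  · rw [h]; push_cast; rw [norm_div, norm_mul, norm_mul, huW, huV, ha, hc]; norm_num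
  · rw [h]; push_cast; rw [norm_neg, norm_div, norm_mul, norm_mul, huW, huV, ha, hc]; norm_num

/-! ### §4 The certificate of `W` from the `V`-side MINUS-symbol certificate data -/

/-- **THE CERTIFICATE OF `W = V ⊗ χ_{−p}` COMPUTED ON THE MINUS SYMBOL OF `V`** (`p ≡ 3 mod 4`, in
particular the `p = 3` block; cells (G, e = 2) and (M): `V` good or multiplicative at `p`). Inputs:
`C • V^{(−p)} = W` (both globally minimal), `W` additive at `p`; the newforms `f_V`, `f_W` at levels
`N_V ∣ N_W`, `p² ∣ N_W`; the period transfers `Ω_W = u_W Ω⁺_{f_W}`, `|Ω⁻(V)| = u_V Ω⁻_{f_V}` with `p`-adic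
units; `p`-integral minus symbols of `f_V`; `a_q(W) ≡ (q/p)a_q(V)` at the Kolyvagin primes of `(W,p)`; and
the `V`-SIDE CERTIFICATE DATA — `μ` periodic, `T_q`-eigen with `a_q(V)` there,
`[r]⁻_{f_V} ≡ μ(r) − wμ(ℓr)` (computed per pair in the sign `−1` modular symbols of level `N_V/ℓ`),
`p ∤ ℓ`, `w·(ℓ/p) = 1`. Output: `PlusSymbolLevelLowersAt W p f_W ℓ`. NO named fact: Pal for `d < 0` and
`|u(C)|_p = 1` are tree theorems. [cite: Pal2012, Thm. 3.2 and Prop. 2.5]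
[cite: Kim2022StructureSelmer, §1.2.2 and §1.4.3] [cite: MazurTateTeitelbaum1986Invent, §I.8] -/
theorem plusSymbolLevelLowersAt_of_twist_certificate_minus (hp4 : p % 4 = 3)
    (V W : WeierstrassCurve ℚ) [V.IsElliptic] [V.IsGloballyMinimal] [W.IsElliptic] [W.IsGloballyMinimal]
    (C : VariableChange ℚ) (hC : C • V.quadraticTwist (-(p : ℚ)) = W) (hVred : Good V p ∨ Mult V p)
    (hadd : Addv W p) {NV NW : ℕ} [NeZero NV] [NeZero NW] {fV : CuspForm (Gamma0 NV) 2}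
    {fW : CuspForm (Gamma0 NW) 2} (hfV : IsNewformOf V fV) (hfW : IsNewformOf W fW) (hN : NV ∣ NW)
    (hm : p ^ 2 ∣ NW)
    (hperW : ∃ u : ℚ, ‖(u : ℚ_[p])‖ = 1 ∧ W.realPeriodRat = u * plusPeriod fW)
    (hperV : ∃ u : ℚ, ‖(u : ℚ_[p])‖ = 1 ∧ V.imaginaryPeriodRat = u * minusPeriod fV)
    (hint : ∀ x : ℚ, ¬ p ∣ (ratMinusSymbol fV x).den)
    {μ : ℚ → ZMod p} (hμ : IsPeriodic μ) {w : ZMod p} {ℓ : ℕ} (hℓ : ¬ p ∣ ℓ)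
    (hV : ∀ r : ℚ, ((ratMinusSymbol fV r : ℚ) : ZMod p) = μ r - w * μ (ℓ * r))
    (hw : w * ((legendreSym p (ℓ : ℤ) : ℤ) : ZMod p) = 1)
    (hHV : ∀ q : ℕ, Kato.IsKolyvaginPrime W p 1 q → HeckeRel μ q (V.frobeniusTrace q : ZMod p))
    (haq : ∀ q : ℕ, Kato.IsKolyvaginPrime W p 1 q →
      (W.frobeniusTrace q : ZMod p) = ((legendreSym p (q : ℤ) : ℤ) : ZMod p) * V.frobeniusTrace q) :
    PlusSymbolLevelLowersAt W p fW ℓ := by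
  haveI : NeZero p := ⟨hp.out.ne_zero⟩
  have hp2 : p ≠ 2 := by omega
  obtain ⟨c₀, hc₀, hrel⟩ :=
    exists_rat_ratPlusSymbol_eq_legendreTwistMinusSum p hp4 V W ⟨C, hC⟩ hadd hfV hfW hN hm
  by_cases hex : ∃ r : ℚ,
      ∑ u : ZMod p, (legendreSym p (u.val : ℤ) : ℚ) * ratMinusSymbol fV (r + (u.val : ℚ) / p) ≠ 0
  · obtain ⟨hχ1, hχq, _⟩ := jacobiChar_prime_ne_one_isQuadratic_isPrimitive p hp2
    have hχo := jacobiChar_odd_of_mod_four_eq_three p hp4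
    have hτ : gaussSum (jacobiChar p) (ZMod.stdAddChar (N := p)) ^ 2 = -(p : ℂ) := by
      rw [gaussSum_sq hχ1 hχq (ZMod.isPrimitive_stdAddChar p), hχo, ZMod.card]
      ring
    -- Pal for `d = −p < 0` (tree theorem) and `|u(C)|_p = 1`
    have hpal := V.realPeriodRat_mul_sqrt_of_twist_of_neg (d := -(p : ℚ))
      (neg_lt_zero.mpr (by exact_mod_cast hp.out.pos)) W C hC
    have hsq : Real.sqrt (-((-(p : ℚ) : ℚ) : ℝ)) = Real.sqrt p := by push_cast; rw [neg_neg]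
    rw [hsq] at hpal
    have hu0 : padicValRat p (C.u : ℚ) = 0 :=
      padicValRat_u_eq_zero_of_twist_pm_p p hp2 V W hVred (d := -(p : ℤ)) (Or.inr rfl) C
        (by push_cast; exact hC)
    have hua : ‖((|(C.u : ℚ)| : ℚ) : ℚ_[p])‖ = 1 := by
      have hne : (C.u : ℚ) ≠ 0 := by exact_mod_cast C.u.ne_zero
      have h1 : ‖((C.u : ℚ) : ℚ_[p])‖ = 1 := by
        rw [Padic.eq_padicNorm, padicNorm.eq_zpow_of_nonzero hne, hu0, neg_zero, zpow_zero,
          Rat.cast_one]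
      rcases abs_choice (C.u : ℚ) with h | h
      · rw [h, h1]
      · rw [h, Rat.cast_neg, norm_neg, h1]
    have hcinf : ‖((((W.baseChange ℝ).numRealComponents : ℕ) : ℚ) : ℚ_[p])‖ = 1 := by
      rw [numRealComponents]
      split_ifs
      · haveI : Fact (Nat.Prime 2) := ⟨Nat.prime_two⟩
        have h2 : padicNorm p ((2 : ℕ) : ℚ) = 1 := padicNorm.padicNorm_of_prime_of_ne hp2
        rw [Nat.cast_ofNat] at h2
        rw [Nat.cast_ofNat, Padic.eq_padicNorm, h2, Rat.cast_one]
      · simp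
    have hPal' : W.realPeriodRat * Real.sqrt p =
        ((|(C.u : ℚ)| : ℚ) : ℝ) * ((((W.baseChange ℝ).numRealComponents : ℕ) : ℚ) : ℝ) *
          V.imaginaryPeriodRat := by
      rw [Rat.cast_abs, Rat.cast_natCast]
      exact hpal
    obtain ⟨uW, huW, hΩW⟩ := hperW
    obtain ⟨uV, huV, hΩV⟩ := hperV
    have hunit : ‖(c₀ : ℚ_[p])‖ = 1 :=
      norm_ratCast_eq_one_of_period_relation_odd p hτ (hrel hex) hPal' hΩW hΩV huW huV hua hcinf
        W.realPeriodRat_pos_holds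
    have hc : ¬ p ∣ c₀.den := not_dvd_den_of_norm_ratCast_le_one hunit.le
    exact plusSymbolLevelLowersAt_of_legendreTwist_minus W V fW fV c₀ hc hint hc₀ hμ hℓ hV hw hHV haq
  · simp only [not_exists, not_not] at hex
    refine ⟨0, fun _ _ ↦ rfl, fun q _ r ↦ by simp, fun r ↦ ?_⟩
    rw [hc₀ r, hex r, mul_zero, Rat.cast_zero, Pi.zero_apply, Pi.zero_apply, sub_zero]

end Summit.BirchSwinnertonDyer.Rank1Residual.Additive

end
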